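import Summits.CriticalPhenomena.PercolationContinuityZ3.Theorems.PercNearOneGluingNoHeavyLowerTailSahiCTCRtThreeCertNine
import Summits.CriticalPhenomena.PercolationContinuityZ3.Theorems.PercNearOneGluingNoHeavyLowerTailSahiCTCRtThreeDrop
import HarnessLib

/-!
# `NoHeavyLowerTail` (crux stmt-CriticalPhenomena-4575), P3 lane: the squarefree row of `R_3 ∈ ℕ[s]` for every number of points from the
# vertex-deletion drop at TEN OR MORE points (memo g49 §3.5, §4)

Support file (seat `prim-l12-p3`, gen 49; `--supports stmt-CriticalPhenomena-4575`).  Memo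
`run/shared/lean/prim/prim-l12/FROM-prim-l12-p3-g49-SEPARABLE-CERTIFICATES.md` §4.

* **`coeff_ind_Rt_three_nonneg_of_drop_ten`** : for a loop-free pair of up-sets on `V`: if every `W ⊆ V` with `10 ≤ #W` has a vertex `v ∈ W` with
  `[s^{W ∖ {v}}] R_3 ≤ [s^W] R_3` (conjecture (MONO) of the memo, 0 failures), then `[s^V] R_3(𝒳,𝒵) ≥ 0` — the base `#W ≤ 9` is the certificate theorem
  `coeff_ind_Rt_three_nonneg_of_card_le_nine` (…RtThreeCertNine); this sharpens `coeff_ind_Rt_three_nonneg_of_drop` (base `#W ≤ 7`).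
Nothing is asserted about the crux; the drop hypothesis is open.
-/

noncomputable section

open scoped Classical

namespace Summit.CriticalPhenomena.PercolationContinuityZ3.Theorems.SahiCTCForms

open Finset MvPolynomial SahiCTCGenFun

variable {α : Type*} [DecidableEq α] [Fintype α]

section DropTen
variable {F G : Finset (Finset α)}

/-- **ROW 0 ⟸ (MONO) at ten or more points.**  For a loop-free pair of up-sets on `V`: if for every `W ⊆ V` with at least ten points some
vertex `v ∈ W` has `[s^{W ∖ {v}}] R_3 ≤ [s^W] R_3`, then `[s^V] R_3(𝒳,𝒵) ≥ 0`.  (Base: `coeff_ind_Rt_three_nonneg_of_card_le_nine`.) [this work] -/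
theorem coeff_ind_Rt_three_nonneg_of_drop_ten (hF : IsUpperSet (F : Set (Finset α))) (hG : IsUpperSet (G : Set (Finset α)))
    (V : Finset α) (h0F : ∅ ∉ F) (h0G : ∅ ∉ G) (h1F : ∀ v ∈ V, ({v} : Finset α) ∉ F) (h1G : ∀ v ∈ V, ({v} : Finset α) ∉ G)
    (hdrop : ∀ W ⊆ V, 10 ≤ #W → ∃ v ∈ W, (Rt 3 F G).coeff (ind (W.erase v)) ≤ (Rt 3 F G).coeff (ind W)) :
    0 ≤ (Rt 3 F G).coeff (ind V) := by
  -- strong induction on the number of points of `W ⊆ V`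
  suffices h : ∀ (n : ℕ) (W : Finset α), W ⊆ V → #W ≤ n → 0 ≤ (Rt 3 F G).coeff (ind W) from h (#V) V Subset.rfl le_rfl
  intro n
  induction n with
  | zero =>
    intro W hWV hW
    exact coeff_ind_Rt_three_nonneg_of_card_le_nine hF hG W (by omega) h0F h0G (fun v hv => h1F v (hWV hv)) (fun v hv => h1G v (hWV hv))
  | succ n ih =>
    intro W hWV hW
    by_cases h9 : #W ≤ 9
    · exact coeff_ind_Rt_three_nonneg_of_card_le_nine hF hG W h9 h0F h0G (fun v hv => h1F v (hWV hv)) (fun v hv => h1G v (hWV hv))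
    · obtain ⟨v, hvW, hv⟩ := hdrop W hWV (by omega)
      have hcard : #(W.erase v) ≤ n := by rw [card_erase_of_mem hvW]; omega
      exact le_trans (ih (W.erase v) ((erase_subset v W).trans hWV) hcard) hv

end DropTen

end Summit.CriticalPhenomena.PercolationContinuityZ3.Theorems.SahiCTCForms
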